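import Literature.Analysis.FluidPDE.ForwardHeatPotentials
import Literature.Analysis.FluidPDE.HeatNewtonIdentity
import HarnessLib

/-!
# The third derivatives of the heat flow of the truncated Newtonian kernel: the multiplier part
# and the smooth remainder

Analysis/FluidPDE support file (everything proved) in the decomposition of the named fact
`Literature.Analysis.FluidPDE.LemarieRieusset2016.lemma13_6_duhamel` (`CKNMorreyHolder.lean`:
Lemarié-Rieusset 2016, §13.9 Step 3, (13.50)–(13.52) and the proof of Lemma 13.6, pp. 474–478).
In the duality form of the localised equations (`CKNMorreyDualIdentity.lean`) the
Calderón–Zygmund pressure term is `-∑ᵢⱼ ∫ φ uᵢuⱼ ∂ⱼ∂ᵢΞ`, `Ξ = 𝒰_ν[∂_c N g]`, whose kernel after the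
duality passage is the backward kernel of the family `a ↦ ∂ᵤ∂ᵥ∂_c e^{νaΔ}Γ₀`
(`fderiv_fderiv_heatDuhamelBack_fderiv_newtonNearPotential_eq_convolution_nu`), `Γ₀` the
truncated Newtonian kernel, `λ = Δ((1 - θ)Γ)` its smoothing remainder. The tree represents
`∂ᵤ∂ᵥ∂_c e^{aΔ}Γ₀ = -∫_a^∞ (D³G_s - ∂ᵤ∂ᵥ∂_c e^{sΔ}λ) ds` (`heatD3_newtonNear_eq_neg_integral_Ioi`)
and the Gaussian part is the kernel of the Fourier multiplier `∂ᵤ∂ᵥ∂_cΔ⁻¹e^{aΔ}`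
(`multiplierHeatKernel_oseenSymbol`). This file turns the reflected potential of this family into
the objects of the named fact — a `multiplierHeatPotential` with the homogeneous symbol
`oseenSymbol u v c` plus a heat potential of a smeared datum (the latter goes to the slot `η` of
Lemma 13.6, having bounded `L¹` density without compact support):

* `newtonFarLaplacianD3 r₀ r₁ u v c = ∂ᵤ∂ᵥ∂_cλ` (smooth, compactly supported) and
  `heatD3_newtonFarLaplacian_eq_heatExtension` (`∂ᵤ∂ᵥ∂_c e^{rΔ}λ = e^{rΔ}∂ᵤ∂ᵥ∂_cλ`), with the
  integrable majorant `exists_bound_heatD3_newtonFarLaplacian` (`≤ sup|∂³λ|` for `r ≤ 1`,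
  `≤ (4π r)^{-3/2}‖∂³λ‖₁` for `r > 1`);
* `newtonFarD3Profile r₀ r₁ u v c (ξ) = ∫_0^∞ ∂ᵤ∂ᵥ∂_c e^{rΔ}λ (ξ) dr` — continuous, bounded,
  integrable (`∫_0^∞ ‖∂³e^{rΔ}λ‖₁ dr < ∞`, the tree's
  `exists_lintegral_Ioi_eLpNorm_heatD3_newtonFarLaplacian_le`), and
  **`e^{θΔ}(newtonFarD3Profile) = ∫_θ^∞ ∂ᵤ∂ᵥ∂_c e^{sΔ}λ ds`** (`heatExtension_newtonFarD3Profile`: Fubini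
  and the semigroup law);
* `heatD3_newtonNear_eq_re_add` — **the kernel splitting**
  `∂ᵤ∂ᵥ∂_c e^{aΔ}Γ₀(ξ) = Re (multiplierHeatKernel (oseenSymbol u v c) a ξ) + e^{aΔ}(newtonFarD3Profile)(ξ)`;
* `multiplierHeatKernel_oseenSymbol_neg` (the multiplier kernel is odd),
  `multiplierHeatPotential_oseenSymbol_im` (the multiplier potential of real data is real);
* `convolution_reflect_backKernel_heatD3_newtonNear` — **the forward form of the
  Calderón–Zygmund term**: wherever the reflected potential converges absolutely,
  `((backKernel (a ↦ ∂ᵤ∂ᵥ∂_c e^{νaΔ}Γ₀))ˇ ⋆ F)(w) = -Re (multiplierHeatPotential ν (oseenSymbol u v c) F w)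
    + heatPotential ν (q ↦ ∫ newtonFarD3Profile(y - q.2) F(q.1, y) dy) (w)`.

## Mathlib / tree search

Tree (all used): `heatD3`, `heatD3_newtonNear_eq_neg_integral_Ioi`, `heatD3_eq_heatExtension_fderiv3`,
`eLpNorm_heatD3_le_of_contDiff`, `exists_lintegral_Ioi_eLpNorm_heatD3_newtonFarLaplacian_le`,
`aestronglyMeasurable_uncurry_restrict_of_continuousOn`, `continuousOn_uncurry_heatD3`
(`HeatNewtonIdentity`, `OseenHeat`), `iteratedFDeriv_three_heatKernel_apply`,
`exists_oseenWeightA_le`, `exists_oseenWeightB_le` (`KochTataruKernel*`),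
`multiplierHeatKernel_oseenSymbol_re/_im` (`HeatKernelMultiplierDerivatives`),
`convolution_reflect_backKernel_heatExtension` (`ForwardHeatPotentials`), `enorm_heatExtension_le`,
`norm_heatExtension_le`, `heatExtension_add_holds`, `contDiff_heatExtension_holds`
(`UnboundedOperators/*`). Mathlib: `continuous_of_dominated`, `lintegral_lintegral_swap`,
`integral_integral_swap`, `integral_add_right_eq_self`, `integrableOn_Ioi_rpow_of_lt`,
`Real.fourierInv_eq_fourier_neg`, `Real.fourierInv_eq_fourier_comp_neg`.

## References

* P. G. Lemarié-Rieusset, *The Navier–Stokes Problem in the 21st Century*, CRC Press (2016),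
  §6.2 (the Oseen tensor), Prop. 13.4 p. 464, §13.9 Step 3, (13.50)–(13.52), pp. 474–475.
  [LemarieRieusset2016]
* H. Koch, D. Tataru, Adv. Math. 157 (2001), §2 (5)–(8) (the kernel of `e^{τΔ}Π∇·`).
  [KochTataruAdvMath2001]
-/

noncomputable section

open MeasureTheory Set Function Filter Metric Real ContinuousLinearMap TopologicalSpace
open scoped ENNReal NNReal Topology RealInnerProductSpace Convolution FourierTransform

namespace Literature.Analysis.FluidPDE

variable {r₀ r₁ : ℝ}

/-! ### `∂ᵤ∂ᵥ∂_c λ` and the heat flow of `λ` -/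

section Lambda

/-- **`∂ᵤ∂ᵥ∂_c λ`**, the third directional derivative of the smoothing remainder
`λ = newtonFarLaplacian r₀ r₁` of the truncated Newtonian kernel (a smooth compactly supported
function; `∂ᵤ∂ᵥ∂_c e^{rΔ}λ = e^{rΔ}∂ᵤ∂ᵥ∂_cλ`). [folklore] -/
def newtonFarLaplacianD3 (r₀ r₁ : ℝ) (u v c : EuclideanSpace ℝ (Fin 3))
    (y : EuclideanSpace ℝ (Fin 3)) : ℝ :=
  fderiv ℝ (fun z => fderiv ℝ (fun z' => fderiv ℝ (newtonFarLaplacian r₀ r₁) z' c) z v) y u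

variable (h₀ : 0 < r₀) (h₁ : r₀ < r₁)
include h₀ h₁

/-- `∂ᵤ∂ᵥ∂_c λ` is smooth and compactly supported. [folklore] -/
theorem contDiff_hasCompactSupport_newtonFarLaplacianD3 (u v c : EuclideanSpace ℝ (Fin 3)) :
    ContDiff ℝ ((⊤ : ℕ∞) : WithTop ℕ∞) (newtonFarLaplacianD3 r₀ r₁ u v c) ∧
      HasCompactSupport (newtonFarLaplacianD3 r₀ r₁ u v c) := by
  have hlamC := contDiff_newtonFarLaplacian h₀ h₁ (n := ⊤)
  have hlamc := hasCompactSupport_newtonFarLaplacian h₀.le h₁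
  obtain ⟨hg₁, hg₁c⟩ := contDiff_hasCompactSupport_fderiv_apply hlamC hlamc c
  obtain ⟨hg₂, hg₂c⟩ := contDiff_hasCompactSupport_fderiv_apply hg₁ hg₁c v
  exact contDiff_hasCompactSupport_fderiv_apply hg₂ hg₂c u

/-- `∂ᵤ∂ᵥ∂_c λ ∈ L¹`. [folklore] -/
theorem memLp_one_newtonFarLaplacianD3 (u v c : EuclideanSpace ℝ (Fin 3)) :
    MemLp (newtonFarLaplacianD3 r₀ r₁ u v c) 1 volume := by
  obtain ⟨h1, h2⟩ := contDiff_hasCompactSupport_newtonFarLaplacianD3 h₀ h₁ u v c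
  exact memLp_one_of_contDiff_hasCompactSupport h1 h2

/-- **Derivatives fall on `λ`**: `heatD3 r u v c λ = e^{rΔ}(∂ᵤ∂ᵥ∂_cλ)` for `r > 0`. [folklore] -/
theorem heatD3_newtonFarLaplacian_eq_heatExtension {r : ℝ} (hr : 0 < r)
    (u v c : EuclideanSpace ℝ (Fin 3)) :
    heatD3 r u v c (newtonFarLaplacian r₀ r₁) =
      UnboundedOperators.heatExtension (newtonFarLaplacianD3 r₀ r₁ u v c) r :=
  heatD3_eq_heatExtension_fderiv3 (contDiff_newtonFarLaplacian h₀ h₁ (n := ⊤))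
    (hasCompactSupport_newtonFarLaplacian h₀.le h₁) hr u v c

/-- **An integrable majorant for `r ↦ ∂ᵤ∂ᵥ∂_c e^{rΔ}λ`**: there is `g ≥ 0`, integrable on
`(0, ∞)`, with `|heatD3 r u v c λ (ξ)| ≤ g(r)` for all `r > 0`, `ξ` — namely `sup|∂³λ|` for
`r ≤ 1` (maximum principle) and `(4πr)^{-3/2}‖∂³λ‖₁` for `r > 1`. [folklore] -/
theorem exists_bound_heatD3_newtonFarLaplacian (u v c : EuclideanSpace ℝ (Fin 3)) :
    ∃ g : ℝ → ℝ, (∀ r, 0 ≤ g r) ∧ IntegrableOn g (Ioi 0) volume ∧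
      ∀ {r : ℝ}, 0 < r → ∀ ξ, |heatD3 r u v c (newtonFarLaplacian r₀ r₁) ξ| ≤ g r := by
  set ψ := newtonFarLaplacianD3 r₀ r₁ u v c with hψ
  obtain ⟨hψC, hψc⟩ := contDiff_hasCompactSupport_newtonFarLaplacianD3 h₀ h₁ u v c
  have hψ1 : MemLp ψ 1 volume := memLp_one_newtonFarLaplacianD3 h₀ h₁ u v c
  obtain ⟨M, hM⟩ := hψc.exists_bound_of_continuous hψC.continuous
  have hM0 : 0 ≤ M := (norm_nonneg _).trans (hM 0)
  set A : ℝ := (4 * π) ^ (-(3 : ℝ) / 2) * (eLpNorm ψ 1 volume).toReal with hA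
  have hA0 : 0 ≤ A := by positivity
  refine ⟨fun r => if r ≤ 1 then M else A * r ^ (-(3 : ℝ) / 2), fun r => ?_, ?_, fun {r} hr ξ => ?_⟩
  · dsimp only
    split_ifs with hr1
    · exact hM0
    · exact mul_nonneg hA0 (Real.rpow_nonneg (by linarith [not_le.1 hr1]) _)
  · -- integrability on `(0, 1]` and on `(1, ∞)`
    rw [← Ioc_union_Ioi_eq_Ioi zero_le_one]
    refine IntegrableOn.union ?_ ?_
    · refine (integrableOn_const (C := M) (measure_Ioc_lt_top (a := (0 : ℝ)) (b := 1)).ne).congr_fun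
        (fun r hr => ?_) measurableSet_Ioc
      dsimp only
      rw [if_pos hr.2]
    · have h : IntegrableOn (fun r : ℝ => A * r ^ (-(3 : ℝ) / 2)) (Ioi 1) volume :=
        (integrableOn_Ioi_rpow_of_lt (by norm_num : (-(3 : ℝ) / 2) < -1) zero_lt_one).const_mul A
      refine h.congr_fun (fun r hr => ?_) measurableSet_Ioi
      dsimp only
      rw [if_neg (not_le.2 hr)]
  · rw [heatD3_newtonFarLaplacian_eq_heatExtension h₀ h₁ hr]
    dsimp only
    split_ifs with hr1
    · rw [← Real.norm_eq_abs]
      exact UnboundedOperators.norm_heatExtension_le hM hr ξ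
    · -- `‖e^{rΔ}ψ(ξ)‖ ≤ (4πr)^{-3/2} ‖ψ‖₁`
      have h := UnboundedOperators.enorm_heatExtension_le hψ1 le_rfl hr ξ
      simp only [inv_one, ENNReal.toReal_one, ENNReal.rpow_one] at h
      have hfin : eLpNorm ψ 1 volume ≠ ∞ := hψ1.eLpNorm_ne_top
      have h3 : (Module.finrank ℝ (EuclideanSpace ℝ (Fin 3)) : ℝ) = 3 := by simp
      rw [h3] at h
      rw [← Real.norm_eq_abs, ← toReal_enorm]
      have hne : ENNReal.ofReal ((4 * π * r) ^ (-(3 : ℝ) / 2)) * eLpNorm ψ 1 volume ≠ ∞ :=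
        ENNReal.mul_ne_top ENNReal.ofReal_ne_top hfin
      calc (‖UnboundedOperators.heatExtension ψ r ξ‖ₑ).toReal
          ≤ (ENNReal.ofReal ((4 * π * r) ^ (-(3 : ℝ) / 2)) * eLpNorm ψ 1 volume).toReal :=
            ENNReal.toReal_mono hne h
        _ = (4 * π * r) ^ (-(3 : ℝ) / 2) * (eLpNorm ψ 1 volume).toReal := by
            rw [ENNReal.toReal_mul, ENNReal.toReal_ofReal (by positivity)]
        _ = A * r ^ (-(3 : ℝ) / 2) := by
            rw [hA, Real.mul_rpow (by positivity) hr.le]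
            ring

/-- Joint continuity of `(r, ξ) ↦ heatD3 r u v c λ (ξ)` on `(0, ∞) × ℝ³`. [folklore] -/
theorem continuousOn_heatD3_newtonFarLaplacian (u v c : EuclideanSpace ℝ (Fin 3)) :
    ContinuousOn (fun q : ℝ × EuclideanSpace ℝ (Fin 3) =>
      heatD3 q.1 u v c (newtonFarLaplacian r₀ r₁) q.2) (Ioi 0 ×ˢ univ) := by
  have h := continuousOn_uncurry_heatD3 (memLp_one_newtonFarLaplacian h₀ h₁) u v c
  exact h

/-- For fixed `ξ`, `r ↦ heatD3 r u v c λ (ξ)` is a.e. strongly measurable on `(0, ∞)`. [folklore] -/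
theorem aestronglyMeasurable_heatD3_newtonFarLaplacian_time (u v c ξ : EuclideanSpace ℝ (Fin 3)) :
    AEStronglyMeasurable (fun r => heatD3 r u v c (newtonFarLaplacian r₀ r₁) ξ)
      (volume.restrict (Ioi 0)) := by
  have h := continuousOn_heatD3_newtonFarLaplacian h₀ h₁ u v c
  have hg : Continuous fun r : ℝ => ((r, ξ) : ℝ × EuclideanSpace ℝ (Fin 3)) := by fun_prop
  have h2 := h.comp hg.continuousOn (fun r (hr : r ∈ Ioi (0 : ℝ)) =>
    show (r, ξ) ∈ Ioi (0 : ℝ) ×ˢ (univ : Set (EuclideanSpace ℝ (Fin 3))) from ⟨hr, mem_univ _⟩)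
  exact h2.aestronglyMeasurable measurableSet_Ioi

/-- For fixed `r > 0`, `ξ ↦ heatD3 r u v c λ (ξ)` is continuous. [folklore] -/
theorem continuous_heatD3_newtonFarLaplacian_space {r : ℝ} (hr : 0 < r)
    (u v c : EuclideanSpace ℝ (Fin 3)) :
    Continuous (heatD3 r u v c (newtonFarLaplacian r₀ r₁)) := by
  rw [heatD3_newtonFarLaplacian_eq_heatExtension h₀ h₁ hr]
  exact (UnboundedOperators.contDiff_heatExtension_holds (memLp_one_newtonFarLaplacianD3 h₀ h₁ u v c)
    le_rfl hr).continuous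

end Lambda

/-! ### The profile `∫_0^∞ ∂ᵤ∂ᵥ∂_c e^{rΔ}λ dr` -/

section Profile

/-- **The `λ`-profile** `newtonFarD3Profile r₀ r₁ u v c (ξ) = ∫_0^∞ heatD3 r u v c λ (ξ) dr`, the
physical-space kernel such that `∫_a^∞ ∂ᵤ∂ᵥ∂_c e^{sΔ}λ ds = e^{aΔ}(newtonFarD3Profile)` (Bochner
integral over `(0, ∞)`; absolutely convergent). [folklore] -/
def newtonFarD3Profile (r₀ r₁ : ℝ) (u v c : EuclideanSpace ℝ (Fin 3))
    (ξ : EuclideanSpace ℝ (Fin 3)) : ℝ :=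
  ∫ r in Ioi 0, heatD3 r u v c (newtonFarLaplacian r₀ r₁) ξ

variable (h₀ : 0 < r₀) (h₁ : r₀ < r₁)
include h₀ h₁

/-- The `λ`-profile is continuous (dominated convergence). [folklore] -/
theorem continuous_newtonFarD3Profile (u v c : EuclideanSpace ℝ (Fin 3)) :
    Continuous (newtonFarD3Profile r₀ r₁ u v c) := by
  obtain ⟨g, hg0, hgi, hgb⟩ := exists_bound_heatD3_newtonFarLaplacian h₀ h₁ u v c
  unfold newtonFarD3Profile
  refine continuous_of_dominated (bound := g) (fun ξ => ?_) (fun ξ => ?_) hgi ?_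
  · exact aestronglyMeasurable_heatD3_newtonFarLaplacian_time h₀ h₁ u v c ξ
  · filter_upwards [ae_restrict_mem measurableSet_Ioi] with r hr
    rw [Real.norm_eq_abs]
    exact hgb hr ξ
  · filter_upwards [ae_restrict_mem measurableSet_Ioi] with r hr
    exact continuous_heatD3_newtonFarLaplacian_space h₀ h₁ hr u v c

/-- The `λ`-profile is measurable. [folklore] -/
theorem measurable_newtonFarD3Profile (u v c : EuclideanSpace ℝ (Fin 3)) :
    Measurable (newtonFarD3Profile r₀ r₁ u v c) :=
  (continuous_newtonFarD3Profile h₀ h₁ u v c).measurable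

/-- The `λ`-profile is bounded. [folklore] -/
theorem exists_abs_newtonFarD3Profile_le (u v c : EuclideanSpace ℝ (Fin 3)) :
    ∃ M : ℝ, ∀ ξ, |newtonFarD3Profile r₀ r₁ u v c ξ| ≤ M := by
  obtain ⟨g, hg0, hgi, hgb⟩ := exists_bound_heatD3_newtonFarLaplacian h₀ h₁ u v c
  refine ⟨∫ r in Ioi 0, g r, fun ξ => ?_⟩
  unfold newtonFarD3Profile
  rw [← Real.norm_eq_abs]
  refine norm_integral_le_of_norm_le hgi ?_
  filter_upwards [ae_restrict_mem measurableSet_Ioi] with r hr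
  rw [Real.norm_eq_abs]
  exact hgb hr ξ

/-- **`∫_0^∞ ‖∂³e^{rΔ}λ‖₁ dr < ∞`**: on `(0, 1]` by `‖heatD3 r λ‖₁ ≤ ‖∂³λ‖₁`, on `(1, ∞)` by the
tree's `exists_lintegral_Ioi_eLpNorm_heatD3_newtonFarLaplacian_le`. [folklore] -/
theorem lintegral_Ioi_zero_eLpNorm_heatD3_newtonFarLaplacian_lt_top
    {u v c : EuclideanSpace ℝ (Fin 3)} (hu : ‖u‖ ≤ 1) (hv : ‖v‖ ≤ 1) (hc : ‖c‖ ≤ 1) :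
    ∫⁻ r in Ioi 0, eLpNorm (heatD3 r u v c (newtonFarLaplacian r₀ r₁)) 1 volume < ∞ := by
  obtain ⟨C, hC, hCb⟩ := exists_lintegral_Ioi_eLpNorm_heatD3_newtonFarLaplacian_le h₀ h₁ u v c hu hv hc
  set ψ := newtonFarLaplacianD3 r₀ r₁ u v c with hψ
  have hψ1 : MemLp ψ 1 volume := memLp_one_newtonFarLaplacianD3 h₀ h₁ u v c
  have hlamC := contDiff_newtonFarLaplacian h₀ h₁ (n := ⊤)
  have hlamc := hasCompactSupport_newtonFarLaplacian h₀.le h₁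
  rw [← Ioc_union_Ioi_eq_Ioi zero_le_one]
  refine (lintegral_union_le _ _ _).trans_lt ?_
  have h1 : ∫⁻ r in Ioc 0 1, eLpNorm (heatD3 r u v c (newtonFarLaplacian r₀ r₁)) 1 volume ≤
      eLpNorm ψ 1 volume := by
    calc ∫⁻ r in Ioc 0 1, eLpNorm (heatD3 r u v c (newtonFarLaplacian r₀ r₁)) 1 volume
        ≤ ∫⁻ _ in Ioc (0 : ℝ) 1, eLpNorm ψ 1 volume := by
          refine lintegral_mono_ae ?_
          filter_upwards [ae_restrict_mem measurableSet_Ioc] with r hr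
          exact eLpNorm_heatD3_le_of_contDiff hlamC hlamc hr.1 u v c
      _ = eLpNorm ψ 1 volume * volume (Ioc (0 : ℝ) 1) := setLIntegral_const _ _
      _ = eLpNorm ψ 1 volume := by rw [Real.volume_Ioc, sub_zero, ENNReal.ofReal_one, mul_one]
  have h2 := hCb zero_lt_one
  refine ENNReal.add_lt_top.2 ⟨h1.trans_lt hψ1.eLpNorm_lt_top, h2.trans_lt ENNReal.ofReal_lt_top⟩

/-- The `λ`-profile is integrable. [folklore] -/
theorem integrable_newtonFarD3Profile {u v c : EuclideanSpace ℝ (Fin 3)} (hu : ‖u‖ ≤ 1) (hv : ‖v‖ ≤ 1)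
    (hc : ‖c‖ ≤ 1) : Integrable (newtonFarD3Profile r₀ r₁ u v c) volume := by
  refine ⟨(continuous_newtonFarD3Profile h₀ h₁ u v c).aestronglyMeasurable, ?_⟩
  rw [hasFiniteIntegral_iff_enorm]
  -- Tonelli
  have hmeas : AEStronglyMeasurable (uncurry fun r ξ => heatD3 r u v c (newtonFarLaplacian r₀ r₁) ξ)
      ((volume.restrict (Ioi 0)).prod (volume : Measure (EuclideanSpace ℝ (Fin 3)))) :=
    aestronglyMeasurable_uncurry_restrict_of_continuousOn measurableSet_Ioi subset_rfl
      (continuousOn_heatD3_newtonFarLaplacian h₀ h₁ u v c)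
  calc ∫⁻ ξ, ‖newtonFarD3Profile r₀ r₁ u v c ξ‖ₑ
      ≤ ∫⁻ ξ, ∫⁻ r in Ioi 0, ‖heatD3 r u v c (newtonFarLaplacian r₀ r₁) ξ‖ₑ :=
        lintegral_mono fun ξ => enorm_integral_le_lintegral_enorm _
    _ = ∫⁻ r in Ioi 0, ∫⁻ ξ, ‖heatD3 r u v c (newtonFarLaplacian r₀ r₁) ξ‖ₑ := by
        rw [lintegral_lintegral_swap]
        exact hmeas.prod_swap.aemeasurable.enorm
    _ = ∫⁻ r in Ioi 0, eLpNorm (heatD3 r u v c (newtonFarLaplacian r₀ r₁)) 1 volume := by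
        simp only [eLpNorm_one_eq_lintegral_enorm]
    _ < ∞ := lintegral_Ioi_zero_eLpNorm_heatD3_newtonFarLaplacian_lt_top h₀ h₁ hu hv hc

omit h₀ h₁ in
/-- Translation of a half-line integral: `∫_{r > 0} f(r + θ) dr = ∫_{s > θ} f(s) ds`. [folklore] -/
theorem integral_Ioi_zero_comp_add_right (f : ℝ → ℝ) (θ : ℝ) :
    ∫ r in Ioi 0, f (r + θ) = ∫ s in Ioi θ, f s := by
  rw [← integral_indicator measurableSet_Ioi, ← integral_indicator measurableSet_Ioi]
  have h := integral_add_right_eq_self (μ := (volume : Measure ℝ)) ((Ioi θ).indicator f) θ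
  rw [← h]
  refine integral_congr_ae (Eventually.of_forall fun r => ?_)
  show (Ioi (0 : ℝ)).indicator (fun r => f (r + θ)) r = (Ioi θ).indicator f (r + θ)
  by_cases hr : 0 < r
  · have : r + θ ∈ Ioi θ := by show θ < r + θ; linarith
    rw [indicator_of_mem (show r ∈ Ioi (0 : ℝ) from hr), indicator_of_mem this]
  · have : r + θ ∉ Ioi θ := by intro (hh : θ < r + θ); exact hr (by linarith)
    rw [indicator_of_notMem (show r ∉ Ioi (0 : ℝ) from hr), indicator_of_notMem this]

/-- **`e^{θΔ}(newtonFarD3Profile) = ∫_θ^∞ ∂ᵤ∂ᵥ∂_c e^{sΔ}λ ds`** for `θ > 0` (Fubini over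
`ℝ³ × (0, ∞)`, the semigroup law `e^{θΔ}e^{rΔ} = e^{(r+θ)Δ}` on `∂³λ`, and the translation
`s = r + θ`). [folklore] -/
theorem heatExtension_newtonFarD3Profile (u v c : EuclideanSpace ℝ (Fin 3)) {θ : ℝ} (hθ : 0 < θ)
    (ξ : EuclideanSpace ℝ (Fin 3)) :
    UnboundedOperators.heatExtension (newtonFarD3Profile r₀ r₁ u v c) θ ξ =
      ∫ s in Ioi θ, heatD3 s u v c (newtonFarLaplacian r₀ r₁) ξ := by
  set lam := newtonFarLaplacian r₀ r₁ with hlam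
  set ψ := newtonFarLaplacianD3 r₀ r₁ u v c with hψ
  have hψ1 : MemLp ψ 1 volume := memLp_one_newtonFarLaplacianD3 h₀ h₁ u v c
  obtain ⟨g, hg0, hgi, hgb⟩ := exists_bound_heatD3_newtonFarLaplacian h₀ h₁ u v c
  -- the integrand on `ℝ³ × (0, ∞)`
  set Φ : EuclideanSpace ℝ (Fin 3) → ℝ → ℝ := fun y r =>
    UnboundedOperators.heatKernel θ y * heatD3 r u v c lam (ξ - y) with hΦ
  have hmeasH : AEStronglyMeasurable (uncurry fun r y' => heatD3 r u v c lam y')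
      ((volume.restrict (Ioi 0)).prod (volume : Measure (EuclideanSpace ℝ (Fin 3)))) :=
    aestronglyMeasurable_uncurry_restrict_of_continuousOn measurableSet_Ioi subset_rfl
      (continuousOn_heatD3_newtonFarLaplacian h₀ h₁ u v c)
  -- the substitution `(y, r) ↦ (r, ξ - y)` is measure preserving
  have hmp : MeasurePreserving
      (fun p : EuclideanSpace ℝ (Fin 3) × ℝ => ((p.2, ξ - p.1) : ℝ × EuclideanSpace ℝ (Fin 3)))
      ((volume : Measure (EuclideanSpace ℝ (Fin 3))).prod (volume.restrict (Ioi 0)))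
      ((volume.restrict (Ioi 0)).prod (volume : Measure (EuclideanSpace ℝ (Fin 3)))) := by
    have h1 : MeasurePreserving (Prod.map (fun y : EuclideanSpace ℝ (Fin 3) => ξ - y) (id : ℝ → ℝ))
        ((volume : Measure (EuclideanSpace ℝ (Fin 3))).prod (volume.restrict (Ioi 0)))
        ((volume : Measure (EuclideanSpace ℝ (Fin 3))).prod (volume.restrict (Ioi 0))) :=
      (Measure.measurePreserving_sub_left volume ξ).prod (MeasurePreserving.id _)
    have h2 := (Measure.measurePreserving_swap (μ := (volume : Measure (EuclideanSpace ℝ (Fin 3))))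
      (ν := volume.restrict (Ioi (0 : ℝ)))).comp h1
    exact h2
  have hΦm : AEStronglyMeasurable (uncurry Φ)
      ((volume : Measure (EuclideanSpace ℝ (Fin 3))).prod (volume.restrict (Ioi 0))) := by
    have hK : AEStronglyMeasurable (fun p : EuclideanSpace ℝ (Fin 3) × ℝ => UnboundedOperators.heatKernel θ p.1)
        ((volume : Measure (EuclideanSpace ℝ (Fin 3))).prod (volume.restrict (Ioi 0))) :=
      ((UnboundedOperators.continuous_heatKernel θ).comp continuous_fst).aestronglyMeasurable
    have hH := hmeasH.comp_measurePreserving hmp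
    have hKH := hK.mul hH
    exact hKH
  have hae : ∀ᵐ p ∂((volume : Measure (EuclideanSpace ℝ (Fin 3))).prod (volume.restrict (Ioi (0 : ℝ)))),
      p.2 ∈ Ioi (0 : ℝ) :=
    (Measure.quasiMeasurePreserving_snd (μ := (volume : Measure (EuclideanSpace ℝ (Fin 3))))
      (ν := volume.restrict (Ioi (0 : ℝ)))).ae (ae_restrict_mem measurableSet_Ioi)
  have hΦi : Integrable (uncurry Φ)
      ((volume : Measure (EuclideanSpace ℝ (Fin 3))).prod (volume.restrict (Ioi 0))) := by
    refine ((UnboundedOperators.integrable_heatKernel_holds hθ).mul_prod hgi).mono' hΦm ?_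
    filter_upwards [hae] with p hp
    simp only [uncurry, hΦ]
    rw [norm_mul, Real.norm_of_nonneg (UnboundedOperators.heatKernel_pos hθ _).le, Real.norm_eq_abs]
    exact mul_le_mul_of_nonneg_left (hgb hp _) (UnboundedOperators.heatKernel_pos hθ _).le
  -- the chain of identities
  calc UnboundedOperators.heatExtension (newtonFarD3Profile r₀ r₁ u v c) θ ξ
      = ∫ y, ∫ r in Ioi 0, Φ y r := by
        rw [UnboundedOperators.heatExtension_apply]
        refine integral_congr_ae (ae_of_all _ fun y => ?_)
        dsimp only
        simp only [hΦ, newtonFarD3Profile, smul_eq_mul]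
        exact (integral_const_mul _ _).symm
    _ = ∫ r in Ioi 0, ∫ y, Φ y r := integral_integral_swap hΦi
    _ = ∫ r in Ioi 0, UnboundedOperators.heatExtension (heatD3 r u v c lam) θ ξ := by
        refine integral_congr_ae (ae_of_all _ fun r => ?_)
        dsimp only
        rw [UnboundedOperators.heatExtension_apply]
        simp only [hΦ, smul_eq_mul]
    _ = ∫ r in Ioi 0, UnboundedOperators.heatExtension ψ (r + θ) ξ := by
        refine setIntegral_congr_fun measurableSet_Ioi fun r hr => ?_
        rw [heatD3_newtonFarLaplacian_eq_heatExtension h₀ h₁ hr,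
          UnboundedOperators.heatExtension_add_holds hψ1 le_rfl hr hθ]
    _ = ∫ s in Ioi θ, UnboundedOperators.heatExtension ψ s ξ :=
        integral_Ioi_zero_comp_add_right (fun s => UnboundedOperators.heatExtension ψ s ξ) θ
    _ = ∫ s in Ioi θ, heatD3 s u v c lam ξ := by
        refine setIntegral_congr_fun measurableSet_Ioi fun s hs => ?_
        rw [heatD3_newtonFarLaplacian_eq_heatExtension h₀ h₁ (hθ.trans hs)]

end Profile

/-! ### The kernel splitting -/

section Split

variable (h₀ : 0 < r₀) (h₁ : r₀ < r₁)
include h₀ h₁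

/-- `s ↦ heatD3 s u v c λ (ξ)` is integrable on `(a, ∞)` for `a ≥ 0`. [folklore] -/
theorem integrableOn_Ioi_heatD3_newtonFarLaplacian {a : ℝ} (ha : 0 ≤ a)
    (u v c ξ : EuclideanSpace ℝ (Fin 3)) :
    IntegrableOn (fun s => heatD3 s u v c (newtonFarLaplacian r₀ r₁) ξ) (Ioi a) volume := by
  obtain ⟨g, hg0, hgi, hgb⟩ := exists_bound_heatD3_newtonFarLaplacian h₀ h₁ u v c
  have hsub : Ioi a ⊆ Ioi 0 := Ioi_subset_Ioi ha
  refine (hgi.mono_set hsub).mono'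
    ((aestronglyMeasurable_heatD3_newtonFarLaplacian_time h₀ h₁ u v c ξ).mono_measure
      (Measure.restrict_mono hsub le_rfl)) ?_
  filter_upwards [ae_restrict_mem measurableSet_Ioi] with s hs
  rw [Real.norm_eq_abs]
  exact hgb (ha.trans_lt hs) ξ

omit h₀ h₁ in
/-- `s ↦ D³G_s(ξ)[u, v, c]` is integrable on `(a, ∞)` for `a > 0` (closed form of the third
derivative of the Gaussian and the Gaussian weights of the tree). [folklore] -/
theorem integrableOn_Ioi_iteratedFDeriv_three_heatKernel {a : ℝ} (ha : 0 < a)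
    (u v c ξ : EuclideanSpace ℝ (Fin 3)) :
    IntegrableOn (fun s => iteratedFDeriv ℝ 3 (UnboundedOperators.heatKernel s) ξ ![u, v, c]) (Ioi a)
      volume := by
  obtain ⟨_, -, hA⟩ := exists_oseenWeightA_le (E := EuclideanSpace ℝ (Fin 3))
  obtain ⟨_, -, hB⟩ := exists_oseenWeightB_le (E := EuclideanSpace ℝ (Fin 3))
  have hintA := (hA ha ξ).1
  have hintB := (hB ha ξ).1
  set Q₁ : ℝ := ⟪ξ, u⟫ * ⟪c, v⟫ + ⟪u, c⟫ * ⟪ξ, v⟫ + ⟪ξ, c⟫ * ⟪u, v⟫ with hQ₁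
  set Q₂ : ℝ := ⟪ξ, u⟫ * ⟪ξ, c⟫ * ⟪ξ, v⟫ with hQ₂
  have h : IntegrableOn (fun s : ℝ => UnboundedOperators.heatKernel s ξ / (4 * s ^ 2) * Q₁ -
      UnboundedOperators.heatKernel s ξ / (8 * s ^ 3) * Q₂) (Ioi a) volume :=
    (hintA.mul_const Q₁).sub (hintB.mul_const Q₂)
  refine h.congr_fun (fun s hs => ?_) measurableSet_Ioi
  have hs0 : s ≠ 0 := (ha.trans hs).ne'
  dsimp only
  rw [iteratedFDeriv_three_heatKernel_apply hs0]
  ring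

/-- **The kernel splitting**: for `a > 0`,
`∂ᵤ∂ᵥ∂_c e^{aΔ}Γ₀ (ξ) = Re (multiplierHeatKernel (oseenSymbol u v c) a ξ) + e^{aΔ}(newtonFarD3Profile)(ξ)`
(the tree's `heatD3_newtonNear_eq_neg_integral_Ioi`, `multiplierHeatKernel_oseenSymbol_re` and
`heatExtension_newtonFarD3Profile`). [folklore] -/
theorem heatD3_newtonNear_eq_re_add (u v c : EuclideanSpace ℝ (Fin 3)) {a : ℝ} (ha : 0 < a)
    (ξ : EuclideanSpace ℝ (Fin 3)) :
    heatD3 a u v c (newtonNear r₀ r₁) ξ =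
      (multiplierHeatKernel (oseenSymbol u v c) a ξ).re +
        UnboundedOperators.heatExtension (newtonFarD3Profile r₀ r₁ u v c) a ξ := by
  rw [heatD3_newtonNear_eq_neg_integral_Ioi h₀ h₁ ha u v c ξ, multiplierHeatKernel_oseenSymbol_re ha,
    heatExtension_newtonFarD3Profile h₀ h₁ u v c ha ξ,
    integral_sub (integrableOn_Ioi_iteratedFDeriv_three_heatKernel ha u v c ξ)
      (integrableOn_Ioi_heatD3_newtonFarLaplacian h₀ h₁ ha.le u v c ξ)]
  ring

end Split

/-! ### Parity of the multiplier kernel and realness of the multiplier potential -/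

section Parity

/-- The Oseen symbol is odd. [folklore] -/
theorem oseenSymbol_neg (u v c ξ : EuclideanSpace ℝ (Fin 3)) :
    oseenSymbol u v c (-ξ) = -oseenSymbol u v c ξ := by
  simp only [oseenSymbol_apply, inner_neg_left, norm_neg]
  push_cast
  ring

/-- **The kernel of `∂ᵤ∂ᵥ∂_cΔ⁻¹e^{θΔ}` is odd** (odd symbol, even Gaussian). [folklore] -/
theorem multiplierHeatKernel_oseenSymbol_neg (u v c : EuclideanSpace ℝ (Fin 3)) (θ : ℝ)
    (ξ : EuclideanSpace ℝ (Fin 3)) :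
    multiplierHeatKernel (oseenSymbol u v c) θ (-ξ) = -multiplierHeatKernel (oseenSymbol u v c) θ ξ := by
  unfold multiplierHeatKernel
  set f : EuclideanSpace ℝ (Fin 3) → ℂ := fun ζ =>
    oseenSymbol u v c ζ * (UnboundedOperators.heatSymbol θ ζ : ℂ) with hf
  have hodd : (fun ζ => f (-ζ)) = fun ζ => -f ζ := by
    funext ζ
    simp only [hf, oseenSymbol_neg, heatSymbol_neg]
    ring
  have hneg : 𝓕 (fun ζ => -f ζ) ξ = -𝓕 f ξ := by
    rw [Real.fourier_eq, Real.fourier_eq, ← integral_neg]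
    refine integral_congr_ae (ae_of_all _ fun ζ => ?_)
    dsimp only
    rw [smul_neg]
  calc 𝓕⁻ f (-ξ) = 𝓕 f ξ := by rw [Real.fourierInv_eq_fourier_neg, neg_neg]
    _ = -𝓕⁻ f ξ := by rw [Real.fourierInv_eq_fourier_comp_neg, hodd, hneg, neg_neg]

/-- The forward multiplier kernel of `∂ᵤ∂ᵥ∂_cΔ⁻¹e^{θΔ}` is the real function
`1_{τ>0} Re (multiplierHeatKernel (oseenSymbol u v c) (ντ) y)`. [folklore] -/
theorem multiplierHeatKernelFwd_oseenSymbol {ν : ℝ} (hν : 0 < ν) (u v c : EuclideanSpace ℝ (Fin 3))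
    (p : ℝ × EuclideanSpace ℝ (Fin 3)) :
    multiplierHeatKernelFwd ν (oseenSymbol u v c) p =
      (((if 0 < p.1 then (multiplierHeatKernel (oseenSymbol u v c) (ν * p.1) p.2).re else 0) : ℝ) : ℂ) := by
  unfold multiplierHeatKernelFwd
  split_ifs with h
  · refine Complex.ext (by simp) ?_
    rw [Complex.ofReal_im, multiplierHeatKernel_oseenSymbol_im (mul_pos hν h)]
  · simp

/-- **The multiplier potential of `∂ᵤ∂ᵥ∂_cΔ⁻¹` on real data is real** (as an explicit real
integral). [folklore] -/
theorem multiplierHeatPotential_oseenSymbol_eq_ofReal {ν : ℝ} (hν : 0 < ν)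
    (u v c : EuclideanSpace ℝ (Fin 3)) (F : ℝ × EuclideanSpace ℝ (Fin 3) → ℝ)
    (w : ℝ × EuclideanSpace ℝ (Fin 3)) :
    multiplierHeatPotential ν (oseenSymbol u v c) F w =
      ((∫ z, (if 0 < (w - z).1 then
          (multiplierHeatKernel (oseenSymbol u v c) (ν * (w - z).1) (w - z).2).re else 0) * F z : ℝ) : ℂ) := by
  rw [multiplierHeatPotential, ← integral_complex_ofReal]
  refine integral_congr_ae (ae_of_all _ fun z => ?_)
  dsimp only
  rw [multiplierHeatKernelFwd_oseenSymbol hν, ← Complex.ofReal_mul]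

/-- The multiplier potential of `∂ᵤ∂ᵥ∂_cΔ⁻¹` on real data has vanishing imaginary part. [folklore] -/
theorem multiplierHeatPotential_oseenSymbol_im {ν : ℝ} (hν : 0 < ν)
    (u v c : EuclideanSpace ℝ (Fin 3)) (F : ℝ × EuclideanSpace ℝ (Fin 3) → ℝ)
    (w : ℝ × EuclideanSpace ℝ (Fin 3)) :
    (multiplierHeatPotential ν (oseenSymbol u v c) F w).im = 0 := by
  rw [multiplierHeatPotential_oseenSymbol_eq_ofReal hν, Complex.ofReal_im]

end Parity

/-! ### The forward form of the Calderón–Zygmund term -/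

section Main

variable (h₀ : 0 < r₀) (h₁ : r₀ < r₁)
include h₀ h₁

/-- **The reflected potential against the backward kernel of `a ↦ ∂ᵤ∂ᵥ∂_c e^{νaΔ}Γ₀`, forward
form**: for measurable integrable `F`, `‖u‖, ‖v‖, ‖c‖ ≤ 1`, `ν > 0`, and a point `w` where the
reflected potential converges absolutely,
`((backKernel (a ↦ heatD3 (νa) u v c Γ₀))ˇ ⋆ F)(w)
  = -Re (multiplierHeatPotential ν (oseenSymbol u v c) F w)
    + heatPotential ν (q ↦ ∫ newtonFarD3Profile(y - q.2) F(q.1, y) dy) w`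
(kernel splitting, oddness of the multiplier kernel, and the smearing lemma). [folklore] -/
theorem convolution_reflect_backKernel_heatD3_newtonNear {ν : ℝ} (hν : 0 < ν)
    {u v c : EuclideanSpace ℝ (Fin 3)} (hu : ‖u‖ ≤ 1) (hv : ‖v‖ ≤ 1) (hc : ‖c‖ ≤ 1)
    {F : ℝ × EuclideanSpace ℝ (Fin 3) → ℝ} (hFm : Measurable F) (hF : Integrable F volume)
    (w : ℝ × EuclideanSpace ℝ (Fin 3))
    (hw : Integrable (fun z => backKernel (fun a y => heatD3 (ν * a) u v c (newtonNear r₀ r₁) y) (z - w) *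
      F z) volume) :
    ((fun q => backKernel (fun a y => heatD3 (ν * a) u v c (newtonNear r₀ r₁) y) (-q))
        ⋆[lsmul ℝ ℝ, (volume : Measure (ℝ × EuclideanSpace ℝ (Fin 3)))] F) w =
      -(multiplierHeatPotential ν (oseenSymbol u v c) F w).re +
        heatPotential ν (fun q : ℝ × EuclideanSpace ℝ (Fin 3) =>
          ∫ y, newtonFarD3Profile r₀ r₁ u v c (y - q.2) * F (q.1, y)) w := by
  obtain ⟨M, hM⟩ := exists_abs_newtonFarD3Profile_le h₀ h₁ u v c
  have hμm := measurable_newtonFarD3Profile h₀ h₁ u v c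
  have hμi := integrable_newtonFarD3Profile h₀ h₁ hu hv hc
  -- the three kernels (functions of `z - w`)
  set K : ℝ × EuclideanSpace ℝ (Fin 3) → ℝ :=
    backKernel (fun a y => heatD3 (ν * a) u v c (newtonNear r₀ r₁) y) with hK
  set K₂ : ℝ × EuclideanSpace ℝ (Fin 3) → ℝ :=
    backKernel (fun a y => UnboundedOperators.heatExtension (newtonFarD3Profile r₀ r₁ u v c) (ν * a) y)
    with hK₂
  set K₁ : ℝ × EuclideanSpace ℝ (Fin 3) → ℝ := fun p =>
    if p.1 < 0 then (multiplierHeatKernel (oseenSymbol u v c) (ν * -p.1) p.2).re else 0 with hK₁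
  have hsplit : ∀ p, K p = K₁ p + K₂ p := by
    intro p
    simp only [hK, hK₁, hK₂, backKernel]
    split_ifs with h
    · exact heatD3_newtonNear_eq_re_add h₀ h₁ u v c (mul_pos hν (neg_pos.2 h)) p.2
    · simp
  -- integrability of the two pieces at `w`
  have hK₂b : ∀ p, |K₂ p| ≤ max M 0 := fun p => abs_backKernel_heatExtension_le hM hν p
  have hK₂m : Measurable K₂ := measurable_backKernel (continuousOn_heatExtension_family_nu hμi hν)
  have hi₂ : Integrable (fun z => K₂ (z - w) * F z) volume :=
    hF.bdd_mul (c := max M 0) ((hK₂m.comp (measurable_id.sub measurable_const)).aestronglyMeasurable)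
      (ae_of_all _ fun z => by rw [Real.norm_eq_abs]; exact hK₂b _)
  have hi₁ : Integrable (fun z => K₁ (z - w) * F z) volume := by
    refine (hw.sub hi₂).congr (ae_of_all _ fun z => ?_)
    show K (z - w) * F z - K₂ (z - w) * F z = K₁ (z - w) * F z
    rw [hsplit]; ring
  -- the left-hand side splits
  rw [convolution_reflect_lsmul_real_prod_apply]
  have hLHS : ∫ z, K (z - w) * F z = (∫ z, K₁ (z - w) * F z) + ∫ z, K₂ (z - w) * F z := by
    rw [← integral_add hi₁ hi₂]
    refine integral_congr_ae (ae_of_all _ fun z => ?_)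
    dsimp only
    rw [hsplit]; ring
  rw [hLHS]
  congr 1
  · -- the multiplier part
    rw [multiplierHeatPotential_oseenSymbol_eq_ofReal hν, Complex.ofReal_re, ← integral_neg]
    refine integral_congr_ae (ae_of_all _ fun z => ?_)
    dsimp only
    simp only [hK₁, Prod.fst_sub, Prod.snd_sub, sub_neg, sub_pos]
    by_cases h : z.1 < w.1
    · rw [if_pos h, if_pos h, neg_sub, show z.2 - w.2 = -(w.2 - z.2) by abel,
        multiplierHeatKernel_oseenSymbol_neg, Complex.neg_re]
      ring
    · rw [if_neg h, if_neg h]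
      ring
  · -- the smooth remainder: smearing lemma
    rw [← convolution_reflect_lsmul_real_prod_apply K₂ F w]
    exact convolution_reflect_backKernel_heatExtension (Cμ := M) hμm hM hμi hFm hF hν w

end Main

end Literature.Analysis.FluidPDE
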